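import Summits.QuantumFields.YangMills.Theorems.FluctuationComparisonRegPrIntLOrganTangentTriangularChart
import Summits.QuantumFields.YangMills.Theorems.FluctuationComparisonRegPrIntLOneBondGeometry
import Literature.MathematicalPhysics.QuantumFieldTheory.Balaban1983to89.T4AvgSensitivity
import HarnessLib

/-!
# `FluctuationComparisonRegPrIntLOrganTangentOneBondAtDescend` — (L6a) THE GLUE BETWEEN `descend` AND THE ONE-BOND MAP: the coarse bond value of the
# descended field in its PRIVATE coordinate IS the Stage-1 one-bond map; the environment is BLIND to every private coordinate; small fine fields are GOOD

Cell `ym3-torus` (rung R3 = continuum `SU(2)` Yang–Mills on the three-torus — NOT d = 4, NOT infinite volume, NOT a mass gap, NOT Clay), width seat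
`ym-ust-20520-w5` (gen 21), pen (L6a) (LEAD-20520 w3 g22 18:57:31Z «YOURS — GO»).  `--kind proof --supports stmt-QuantumFields-20520 --as helper`, count-neutral,
definition-free, default heartbeats; THEOREMS ONLY (bookkeeping of tree identities); nothing printed is asserted.

For `F : T3Family`, height `j`, a fine field `U : GaugeField (F.P (j+1)) 0 SU(2)`, a coarse bond `c`, its level reading `ĉ := bondShift (sitesPerDir_descend F j 0) c`
and its PRIVATE fine bond `β c := centralBond ĉ` (✓`…OrganTangentTriangularChart.isLocal_descend`):
* §1 IDENTIFICATION: `descend F ℰp j U c = avgFun ℰp U ĉ` (`descend_apply`); `descend F ℰp j (update U (β c) g) c = fibreMap ℰp U ĉ (pre·g·post)`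
  (`descend_update_private_eq_fibreMap`, ✓`avgFun_update_centralBond_self`); and ON THE FAMILY BALL (`‖openHol U ĉ i − pre·g·post‖ ≤ r < δ` off-central)
  **`descend_update_private_eq`**: `= expMeanLogSU.avg (i ↦ IsCentral ĉ i ? 1 : openHol U ĉ i · W⁻¹) · W`, `W := pre U ĉ · g · post U ĉ` — the Stage-1 one-bond map of
  ✓`…OneBondInverse` at environment `V := openHol U ĉ`, central predicate `IsCentral ĉ` (✓`fibreMap_of_mem`, the `fibreFamily` unfolding); at the field's own
  coordinate `g = U (β c)`: `descend_eq_avg_mul_axialAvg`.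
* §2 BLINDNESS: **`openHol_congr_off_private`** — for an OFF-CENTRAL index, `openHol U' ĉ i = openHol U ĉ i` whenever `U'` agrees with `U` off the private
  bonds of ALL coarse bonds (no private bond of any coarse bond lies on an off-central open word: ✓`BlockAveragingHaarAC.central_of_mem_walk_openWord` +
  `holAt_congr`); corollary `openHol_extend_private` for `Function.extend β g U`, EVERY `g`.
* §3 SMALL ⇒ GOOD (✓`…OneBondGeometry` read at `ĉ`, `t := ((d+2)L)²∕4 · a`): under `PlaqSmall a U`, spread `≤ 2t`, `axialAvg U ĉ` within `t` and `descend F ℰp j U c`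
  within `7t` of every `openHol U ĉ i`.
Consumed by (L6b) `…OrganTangentOneBondData` (the per-bond `T T′ θ` with `hright`, (REG), (SOL), `hmargin` for ✓(L5) v2 and `mass_of_smallLift`).
NOT HERE: the inverse LAW (Stage 2), (C3); nothing of VER∘∕(A)∕COAREA∘∕O1∕20520∕`YM3TorusSU2` is proved.  No `def`, `instance`, `notation`, `sorry`.
-/

set_option autoImplicit false

noncomputable section

namespace Summit.QuantumFields.YangMills.Theorems.FluctuationComparisonRegPrIntLOrganTangentOneBondAtDescend

open Set Function
open Literature.MathematicalPhysics.QuantumFieldTheory.Balaban1983to89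
open T3ContinuumYM3Torus T3NestedUnitLaws T3UnitLawDensityEML T3LevelShift T4Continuum AveragingRT BlockAveraging
open Literature.MathematicalPhysics.QuantumFieldTheory.Balaban1983to89.BlockAveragingHaarAC
  (centralBond openHol IsCentral pre post central_of_mem_walk_openWord axialAvg_eq_pre_mul_mul_post)
open Literature.MathematicalPhysics.QuantumFieldTheory.Balaban1983to89.BlockAveragingEMLHaarAC (fibreFamily fibreMap fibreMap_of_mem avgFun_update_centralBond_self)
open ExpMeanLog (expMeanLogSU deltaSU)
open Summit.QuantumFields.YangMills.Theorems.FluctuationComparisonRegPrIntLOneBondGeometry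
  (norm_openHol_sub_openHol_le norm_openHol_sub_axialAvg_le norm_avgFun_sub_openHol_le norm_openHol_sub_pre_mul_mul_post_le)
open scoped Matrix.Norms.L2Operator

/-! ## §1 Identification: the coarse bond value of `descend` in the private coordinate is the one-bond map -/

/-- The standing range of the level-`(j+1)` torus at lattice level `0`. [folklore] -/
theorem level_ok (F : T3Family) (j : ℕ) : 0 + 1 ≤ (F.P (j + 1)).m + (F.P (j + 1)).K := by
  show 0 + 1 ≤ F.m + (j + 1); omega

/-- **`descend` IS THE (0.4) AVERAGE READ ONE LEVEL UP**: `descend F ℰp j U c = avgFun ℰp U ĉ`, `ĉ := bondShift (sitesPerDir_descend F j 0) c`.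
[cite: Balaban1987RG1, (0.4) and (0.11) p.253] -/
theorem descend_apply (F : T3Family) (j : ℕ) (U : GaugeField (F.P (j + 1)) 0 ↥(Matrix.specialUnitaryGroup (Fin 2) ℂ)) (c : PBond (F.P j) 0) :
    descend F ℰp j U c = avgFun (P := F.P (j + 1)) (j := 0) ℰp U (bondShift (sitesPerDir_descend F j 0) c) := rfl

/-- **THE COARSE BOND VALUE IN THE PRIVATE COORDINATE IS THE FIBRE MAP**: `descend F ℰp j (U[β c := g]) c = fibreMap ℰp U ĉ (pre U ĉ · g · post U ĉ)`.
[cite: Balaban1987RG1, (0.4) p.253] -/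
theorem descend_update_private_eq_fibreMap (F : T3Family) (j : ℕ) (U : GaugeField (F.P (j + 1)) 0 ↥(Matrix.specialUnitaryGroup (Fin 2) ℂ))
    (c : PBond (F.P j) 0) (g : ↥(Matrix.specialUnitaryGroup (Fin 2) ℂ)) :
    descend F ℰp j (update U (centralBond (bondShift (sitesPerDir_descend F j 0) c)) g) c =
      fibreMap (P := F.P (j + 1)) (j := 0) ℰp U (bondShift (sitesPerDir_descend F j 0) c)
        (pre U (bondShift (sitesPerDir_descend F j 0) c) * g * post U (bondShift (sitesPerDir_descend F j 0) c)) := by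
  rw [descend_apply]
  exact avgFun_update_centralBond_self (level_ok F j) ℰp U _ g

/-- **ON THE FAMILY BALL THE FIBRE MAP IS THE STAGE-1 ONE-BOND MAP**: if every off-central open holonomy is within `r < δ` of `W := pre·g·post`, then
`descend F ℰp j (U[β c := g]) c = expMeanLogSU.avg (i ↦ IsCentral ĉ i ? 1 : openHol U ĉ i · W⁻¹) · W` — the map of ✓`…OneBondInverse` at the environment
`V := openHol U ĉ`. [cite: Balaban1987RG1, (0.4) p.253] -/
theorem descend_update_private_eq (F : T3Family) (j : ℕ) (U : GaugeField (F.P (j + 1)) 0 ↥(Matrix.specialUnitaryGroup (Fin 2) ℂ))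
    (c : PBond (F.P j) 0) (g : ↥(Matrix.specialUnitaryGroup (Fin 2) ℂ)) {r : ℝ} (hrδ : r < deltaSU (Fin 2))
    (h : ∀ i, ¬ IsCentral (bondShift (sitesPerDir_descend F j 0) c) i →
      ‖((openHol U (bondShift (sitesPerDir_descend F j 0) c) i : ↥(Matrix.specialUnitaryGroup (Fin 2) ℂ)) : Matrix (Fin 2) (Fin 2) ℂ) -
        ((pre U (bondShift (sitesPerDir_descend F j 0) c) * g * post U (bondShift (sitesPerDir_descend F j 0) c) :
          ↥(Matrix.specialUnitaryGroup (Fin 2) ℂ)) : Matrix (Fin 2) (Fin 2) ℂ)‖ ≤ r) :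
    descend F ℰp j (update U (centralBond (bondShift (sitesPerDir_descend F j 0) c)) g) c =
      (expMeanLogSU (n := Fin 2)).avg (fun i => if IsCentral (bondShift (sitesPerDir_descend F j 0) c) i then
          (1 : ↥(Matrix.specialUnitaryGroup (Fin 2) ℂ)) else
          openHol U (bondShift (sitesPerDir_descend F j 0) c) i *
            (pre U (bondShift (sitesPerDir_descend F j 0) c) * g * post U (bondShift (sitesPerDir_descend F j 0) c))⁻¹) *
        (pre U (bondShift (sitesPerDir_descend F j 0) c) * g * post U (bondShift (sitesPerDir_descend F j 0) c)) := by
  rw [descend_update_private_eq_fibreMap]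
  -- freeze the bond and the argument
  generalize bondShift (sitesPerDir_descend F j 0) c = b at h ⊢
  generalize pre U b * g * post U b = W at h ⊢
  have hguard : W ∈ BlockAveragingEMLHaarAC.fibreGuard (P := F.P (j + 1)) (j := 0) ℰp U b := by
    intro i
    show dist1 (fibreFamily U b W i) < (ℰp).δ
    unfold fibreFamily
    split_ifs with hi
    · rw [GaugeGroup.dist1_one]; exact (ℰp).δ_pos
    · show ‖((openHol U b i : ↥(Matrix.specialUnitaryGroup (Fin 2) ℂ)) : Matrix (Fin 2) (Fin 2) ℂ) *
          star ((W : ↥(Matrix.specialUnitaryGroup (Fin 2) ℂ)) : Matrix (Fin 2) (Fin 2) ℂ) - 1‖ < deltaSU (Fin 2)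
      have hWu : ((W : ↥(Matrix.specialUnitaryGroup (Fin 2) ℂ)) : Matrix (Fin 2) (Fin 2) ℂ) ∈ Matrix.unitaryGroup (Fin 2) ℂ :=
        (Matrix.mem_specialUnitaryGroup_iff.1 W.2).1
      have e : ((openHol U b i : ↥(Matrix.specialUnitaryGroup (Fin 2) ℂ)) : Matrix (Fin 2) (Fin 2) ℂ) *
            star ((W : ↥(Matrix.specialUnitaryGroup (Fin 2) ℂ)) : Matrix (Fin 2) (Fin 2) ℂ) - 1 =
          (((openHol U b i : ↥(Matrix.specialUnitaryGroup (Fin 2) ℂ)) : Matrix (Fin 2) (Fin 2) ℂ) -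
            ((W : ↥(Matrix.specialUnitaryGroup (Fin 2) ℂ)) : Matrix (Fin 2) (Fin 2) ℂ)) *
            star ((W : ↥(Matrix.specialUnitaryGroup (Fin 2) ℂ)) : Matrix (Fin 2) (Fin 2) ℂ) := by
        rw [sub_mul, Unitary.mul_star_self_of_mem hWu]
      rw [e, CStarRing.norm_mul_mem_unitary _ (Unitary.star_mem hWu)]
      exact (h i hi).trans_lt hrδ
  rw [fibreMap_of_mem ℰp U b hguard]
  rfl

/-- **AT THE FIELD'S OWN PRIVATE COORDINATE** the argument of the one-bond map is the straight transporter: for a `PlaqSmall a` field with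
`t := ((d+2)L)²∕4·a < δ`, `descend F ℰp j U c = expMeanLogSU.avg (i ↦ IsCentral ĉ i ? 1 : openHol U ĉ i · (axialAvg U ĉ)⁻¹) · axialAvg U ĉ`.
[cite: Balaban1987RG1, (0.4) p.253; Balaban1985Averaging, (19)-(20) p.21] -/
theorem descend_eq_avg_mul_axialAvg (F : T3Family) (j : ℕ) {a : ℝ} (ha : 0 ≤ a)
    {U : GaugeField (F.P (j + 1)) 0 ↥(Matrix.specialUnitaryGroup (Fin 2) ℂ)} (hU : PlaqSmall a U)
    (ht : (((((F.P (j + 1)).d + 2) * (F.P (j + 1)).L : ℕ) : ℝ) ^ 2 / 4) * a < deltaSU (Fin 2)) (c : PBond (F.P j) 0) :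
    descend F ℰp j U c =
      (expMeanLogSU (n := Fin 2)).avg (fun i => if IsCentral (bondShift (sitesPerDir_descend F j 0) c) i then
          (1 : ↥(Matrix.specialUnitaryGroup (Fin 2) ℂ)) else
          openHol U (bondShift (sitesPerDir_descend F j 0) c) i * (axialAvg U (bondShift (sitesPerDir_descend F j 0) c))⁻¹) *
        axialAvg U (bondShift (sitesPerDir_descend F j 0) c) := by
  have hself : U = update U (centralBond (bondShift (sitesPerDir_descend F j 0) c)) (U (centralBond (bondShift (sitesPerDir_descend F j 0) c))) :=
    (update_eq_self _ U).symm
  have h := descend_update_private_eq F j U c (U (centralBond (bondShift (sitesPerDir_descend F j 0) c))) ht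
    (fun i _ => norm_openHol_sub_pre_mul_mul_post_le ha hU _ i)
  rw [← hself, ← axialAvg_eq_pre_mul_mul_post] at h
  exact h

/-! ## §2 Blindness: the environment does not see any private coordinate -/

/-- **OFF-CENTRAL OPEN HOLONOMIES ARE BLIND TO EVERY PRIVATE COORDINATE** (pointwise form): if `U'` agrees with `U` off the private bonds
`β c′ = centralBond ĉ′` of ALL coarse bonds, then `openHol U' ĉ i = openHol U ĉ i` for `¬ IsCentral ĉ i` — no private bond of any coarse bond lies on an
off-central open word at `ĉ` (✓`central_of_mem_walk_openWord`: such a bond forces `c′ = c` AND centrality of `i`). [cite: Balaban1987RG1, (0.4) p.253 (bookkeeping)] -/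
theorem openHol_congr_off_private (F : T3Family) (j : ℕ) (U U' : GaugeField (F.P (j + 1)) 0 ↥(Matrix.specialUnitaryGroup (Fin 2) ℂ))
    (c : PBond (F.P j) 0) (i : Idx (F.P (j + 1))) (hi : ¬ IsCentral (bondShift (sitesPerDir_descend F j 0) c) i)
    (hU' : ∀ b : PBond (F.P (j + 1)) 0, (¬ ∃ c' : PBond (F.P j) 0, centralBond (bondShift (sitesPerDir_descend F j 0) c') = b) → U' b = U b) :
    openHol U' (bondShift (sitesPerDir_descend F j 0) c) i = openHol U (bondShift (sitesPerDir_descend F j 0) c) i := by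
  unfold openHol
  refine T4AvgSensitivity.holAt_congr fun s hs => hU' _ ?_
  rintro ⟨c', hc'⟩
  exact hi (central_of_mem_walk_openWord (level_ok F j) (bondShift (sitesPerDir_descend F j 0) c)
    (bondShift (sitesPerDir_descend F j 0) c') i.1 i.2.1 i.2.2 hs hc'.symm).2

/-- … in particular for the resampling `Function.extend β g U` of all private coordinates (`β c′ := centralBond ĉ′`), for EVERY `g`.
[cite: Balaban1987RG1, (0.4) p.253 (bookkeeping)] -/
theorem openHol_extend_private (F : T3Family) (j : ℕ) (U : GaugeField (F.P (j + 1)) 0 ↥(Matrix.specialUnitaryGroup (Fin 2) ℂ))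
    (g : PBond (F.P j) 0 → ↥(Matrix.specialUnitaryGroup (Fin 2) ℂ)) (c : PBond (F.P j) 0) (i : Idx (F.P (j + 1)))
    (hi : ¬ IsCentral (bondShift (sitesPerDir_descend F j 0) c) i) :
    openHol (extend (fun c' : PBond (F.P j) 0 => centralBond (bondShift (sitesPerDir_descend F j 0) c')) g U :
        GaugeField (F.P (j + 1)) 0 ↥(Matrix.specialUnitaryGroup (Fin 2) ℂ)) (bondShift (sitesPerDir_descend F j 0) c) i =
      openHol U (bondShift (sitesPerDir_descend F j 0) c) i :=
  openHol_congr_off_private F j U _ c i hi fun _ hb => extend_apply' _ _ _ hb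

/-! ## §3 Small fine fields are good environments with small arguments and nearby coarse values -/

/-- **A `PlaqSmall a` FIELD IS A GOOD ENVIRONMENT AT EVERY COARSE BOND** (`t := ((d+2)L)²∕4·a`): spread `≤ 2t`, the straight transporter within `t`, and —
for `t < δ` — the coarse bond value `descend F ℰp j U c` within `7t` of every open holonomy. [cite: Balaban1985Averaging, Prop. 1 (51) p.26; Balaban1987RG1, (0.4) p.253] -/
theorem small_is_good (F : T3Family) (j : ℕ) {a : ℝ} (ha : 0 ≤ a)
    {U : GaugeField (F.P (j + 1)) 0 ↥(Matrix.specialUnitaryGroup (Fin 2) ℂ)} (hU : PlaqSmall a U)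
    (ht : (((((F.P (j + 1)).d + 2) * (F.P (j + 1)).L : ℕ) : ℝ) ^ 2 / 4) * a < deltaSU (Fin 2)) (c : PBond (F.P j) 0) (i i' : Idx (F.P (j + 1))) :
    ‖((openHol U (bondShift (sitesPerDir_descend F j 0) c) i : ↥(Matrix.specialUnitaryGroup (Fin 2) ℂ)) : Matrix (Fin 2) (Fin 2) ℂ) -
        ((openHol U (bondShift (sitesPerDir_descend F j 0) c) i' : ↥(Matrix.specialUnitaryGroup (Fin 2) ℂ)) : Matrix (Fin 2) (Fin 2) ℂ)‖ ≤
        2 * ((((((F.P (j + 1)).d + 2) * (F.P (j + 1)).L : ℕ) : ℝ) ^ 2 / 4) * a) ∧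
      ‖((openHol U (bondShift (sitesPerDir_descend F j 0) c) i : ↥(Matrix.specialUnitaryGroup (Fin 2) ℂ)) : Matrix (Fin 2) (Fin 2) ℂ) -
          ((axialAvg U (bondShift (sitesPerDir_descend F j 0) c) : ↥(Matrix.specialUnitaryGroup (Fin 2) ℂ)) : Matrix (Fin 2) (Fin 2) ℂ)‖ ≤
        (((((F.P (j + 1)).d + 2) * (F.P (j + 1)).L : ℕ) : ℝ) ^ 2 / 4) * a ∧
      ‖((descend F ℰp j U c : ↥(Matrix.specialUnitaryGroup (Fin 2) ℂ)) : Matrix (Fin 2) (Fin 2) ℂ) -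
          ((openHol U (bondShift (sitesPerDir_descend F j 0) c) i : ↥(Matrix.specialUnitaryGroup (Fin 2) ℂ)) : Matrix (Fin 2) (Fin 2) ℂ)‖ ≤
        7 * ((((((F.P (j + 1)).d + 2) * (F.P (j + 1)).L : ℕ) : ℝ) ^ 2 / 4) * a) := by
  refine ⟨norm_openHol_sub_openHol_le ha hU _ i i', norm_openHol_sub_axialAvg_le ha hU _ i, ?_⟩
  rw [descend_apply]
  exact norm_avgFun_sub_openHol_le ha hU ht _ i

end Summit.QuantumFields.YangMills.Theorems.FluctuationComparisonRegPrIntLOrganTangentOneBondAtDescend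

end
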